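import Summits.Ventures.PercRepro.C026HubCorollary

/-!
# Theorem H, part 5: the `(2×)`-slack `Δ₂` under two-edge hubs (p6, gen 12)

mine-3's THEOREM H (memo §30 add. 4, INBOX 5475) states the hub identities also for the `(2×)`-slack
`Δ₂(G) = #ac|b + #bc|a − 2·#N²` (p5's `TwoTimes` is `0 ≤ Δ₂`):

* **(H1)₂** `Δ₂(G + v_{ab}) = 3·Δ₂(G)` (`slack2_hub2_ab`);
* **(H2)₂** `Δ₂(G + v_{ac}) = 3·Δ₂(G) + #{a ≁ b, b ≁ c} − 2·#X_b` (`slack2_hub2_ac`);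
* (H3)₂ is in `C026HubTimesThree.lean`.

By Lemma Φ (`card_nAB_eq`), `Δ₂ = 2·#ab|c + #ac|b + #bc|a − 2·#N_AB` (`slack2_eq`), so `Δ₂` is the
WEIGHTED slice sum of the same four counts that give `Δ_CF` (weights `2, 1, 1, 2` instead of
`1, 1, 1, 1`): `slice2`, `slice2_eq_of_hubLike`, `slack2_hub2_eq`, and the four slices of each
two-edge hub evaluated by the shape lemmas of `C026HubTwo.lean`.  Corollary: `(2×)` on `G` gives
`(2×)` on `G + v_{ab}` (`twoTimes_hub2_ab`); for the `ac`-hub the identity is exact but the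
inequality is mine-3's CONJECTURE M3-HUB2X, not a theorem.
-/

namespace PercRepro

open Finset

namespace MultiGraph

section Slack2

variable {V E : Type*} [Fintype E] (G : MultiGraph V E)

open Classical in
/-- **mine-3's `(2×)`-slack** `Δ₂(G) = #ac|b + #bc|a − 2·#N²`; `(2×)` (p5's `TwoTimes`) is `0 ≤ Δ₂`. -/
noncomputable def slack2 (a b c : V) : ℤ :=
  ((univ.filter fun ω : Config E => G.Conn ω c a ∧ ¬ G.Conn ω c b).card : ℤ) +
    ((univ.filter fun ω : Config E => G.Conn ω c b ∧ ¬ G.Conn ω c a).card : ℤ) -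
    2 * ((univ.filter fun ω : Config E => G.NTwo ω a b c).card : ℤ)

variable {G}

open Classical in
/-- `(2×)` is `0 ≤ Δ₂`. -/
theorem twoTimes_iff_slack2_nonneg (a b c : V) : G.TwoTimes a b c ↔ 0 ≤ G.slack2 a b c := by
  unfold TwoTimes slack2
  omega

open Classical in
/-- **`Δ₂ = 2·#ab|c + #ac|b + #bc|a − 2·#N_AB`** (Lemma Φ). -/
theorem slack2_eq (a b c : V) :
    G.slack2 a b c =
      2 * ((univ.filter fun ω : Config E => G.Conn ω a b ∧ ¬ G.Conn ω a c).card : ℤ) +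
        ((univ.filter fun ω : Config E => G.Conn ω c a ∧ ¬ G.Conn ω c b).card : ℤ) +
        ((univ.filter fun ω : Config E => G.Conn ω c b ∧ ¬ G.Conn ω c a).card : ℤ) -
        2 * ((univ.filter fun ω : Config E =>
          G.Conn ω a b ∧ ¬ G.Conn ωᶜ c a ∧ ¬ G.Conn ωᶜ c b).card : ℤ) := by
  unfold slack2
  have h := card_nAB_eq (G := G) a b c
  omega

end Slack2

section Slice2

variable {V E : Type*} [Fintype E]

open Classical in
/-- The `(2×)`-weighted slice counts of `H` at `f`: `2·#ab|c + #ac|b + #bc|a − 2·#N_AB` read through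
`f`. -/
noncomputable def slice2 (H : MultiGraph V E) {E₀ : Type*} [Fintype E₀] (f : Config E₀ → Config E)
    (a b c : V) : ℤ :=
  2 * ((univ.filter fun ω : Config E₀ => H.Conn (f ω) a b ∧ ¬ H.Conn (f ω) a c).card : ℤ) +
    ((univ.filter fun ω : Config E₀ => H.Conn (f ω) c a ∧ ¬ H.Conn (f ω) c b).card : ℤ) +
    ((univ.filter fun ω : Config E₀ => H.Conn (f ω) c b ∧ ¬ H.Conn (f ω) c a).card : ℤ) -
    2 * ((univ.filter fun ω : Config E₀ =>
      H.Conn (f ω) a b ∧ ¬ H.Conn (f ω)ᶜ c a ∧ ¬ H.Conn (f ω)ᶜ c b).card : ℤ)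

variable (G : MultiGraph V E)

open Classical in
/-- **`Δ₂` of a two-edge hub graph is the sum over its four hub-state slices.** -/
theorem slack2_hub2_eq (v t₁ t₂ a b c : V) :
    (G.hub2 v t₁ t₂).slack2 a b c =
      (G.hub2 v t₁ t₂).slice2 (fun ω : Config E => extendOpt false (extendOpt false ω)) a b c +
        (G.hub2 v t₁ t₂).slice2 (fun ω => extendOpt false (extendOpt true ω)) a b c +
        ((G.hub2 v t₁ t₂).slice2 (fun ω => extendOpt true (extendOpt false ω)) a b c +
          (G.hub2 v t₁ t₂).slice2 (fun ω => extendOpt true (extendOpt true ω)) a b c) := by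
  have key : 2 * ((univ.filter fun τ : Config (Option (Option E)) =>
        (G.hub2 v t₁ t₂).Conn τ a b ∧ ¬ (G.hub2 v t₁ t₂).Conn τ a c).card : ℤ) +
      ((univ.filter fun τ : Config (Option (Option E)) =>
        (G.hub2 v t₁ t₂).Conn τ c a ∧ ¬ (G.hub2 v t₁ t₂).Conn τ c b).card : ℤ) +
      ((univ.filter fun τ : Config (Option (Option E)) =>
        (G.hub2 v t₁ t₂).Conn τ c b ∧ ¬ (G.hub2 v t₁ t₂).Conn τ c a).card : ℤ) -
      2 * ((univ.filter fun τ : Config (Option (Option E)) =>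
        (G.hub2 v t₁ t₂).Conn τ a b ∧ ¬ (G.hub2 v t₁ t₂).Conn τᶜ c a ∧
          ¬ (G.hub2 v t₁ t₂).Conn τᶜ c b).card : ℤ) =
      (G.hub2 v t₁ t₂).slice2 (fun ω : Config E => extendOpt false (extendOpt false ω)) a b c +
        (G.hub2 v t₁ t₂).slice2 (fun ω => extendOpt false (extendOpt true ω)) a b c +
        ((G.hub2 v t₁ t₂).slice2 (fun ω => extendOpt true (extendOpt false ω)) a b c +
          (G.hub2 v t₁ t₂).slice2 (fun ω => extendOpt true (extendOpt true ω)) a b c) := by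
    unfold slice2
    rw [card_filter_option2, card_filter_option2, card_filter_option2, card_filter_option2]
    push_cast
    ring
  rw [(G.hub2 v t₁ t₂).slack2_eq]
  convert key using 9

variable {G}

open Classical in
/-- **A `(2×)`-slice through the hub invariant.** -/
theorem slice2_eq_of_hubLike {E' : Type*} [Fintype E'] {H : MultiGraph V E'}
    {f : Config E → Config E'} {R R' : Config E → V → Prop} {v a b c : V} (hav : a ≠ v)
    (hbv : b ≠ v) (hcv : c ≠ v) (hH : ∀ ω, HubLike G v H ω (f ω) (R ω))
    (hH' : ∀ ω, HubLike G v H ωᶜ (f ω)ᶜ (R' ω)) :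
    H.slice2 f a b c =
      2 * ((univ.filter fun ω : Config E =>
          (G.Conn ω a b ∨ (R ω a ∧ R ω b)) ∧ ¬ (G.Conn ω a c ∨ (R ω a ∧ R ω c))).card : ℤ) +
        ((univ.filter fun ω : Config E =>
          (G.Conn ω c a ∨ (R ω c ∧ R ω a)) ∧ ¬ (G.Conn ω c b ∨ (R ω c ∧ R ω b))).card : ℤ) +
        ((univ.filter fun ω : Config E =>
          (G.Conn ω c b ∨ (R ω c ∧ R ω b)) ∧ ¬ (G.Conn ω c a ∨ (R ω c ∧ R ω a))).card : ℤ) -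
        2 * ((univ.filter fun ω : Config E =>
          (G.Conn ω a b ∨ (R ω a ∧ R ω b)) ∧ ¬ (G.Conn ωᶜ c a ∨ (R' ω c ∧ R' ω a)) ∧
            ¬ (G.Conn ωᶜ c b ∨ (R' ω c ∧ R' ω b))).card : ℤ) := by
  have e1 : ∀ ω, H.Conn (f ω) a b ↔ G.Conn ω a b ∨ (R ω a ∧ R ω b) := fun ω =>
    (hH ω).conn_iff a b hav hbv
  have e2 : ∀ ω, H.Conn (f ω) a c ↔ G.Conn ω a c ∨ (R ω a ∧ R ω c) := fun ω =>
    (hH ω).conn_iff a c hav hcv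
  have e3 : ∀ ω, H.Conn (f ω) c a ↔ G.Conn ω c a ∨ (R ω c ∧ R ω a) := fun ω =>
    (hH ω).conn_iff c a hcv hav
  have e4 : ∀ ω, H.Conn (f ω) c b ↔ G.Conn ω c b ∨ (R ω c ∧ R ω b) := fun ω =>
    (hH ω).conn_iff c b hcv hbv
  have e5 : ∀ ω, H.Conn (f ω)ᶜ c a ↔ G.Conn ωᶜ c a ∨ (R' ω c ∧ R' ω a) := fun ω =>
    (hH' ω).conn_iff c a hcv hav
  have e6 : ∀ ω, H.Conn (f ω)ᶜ c b ↔ G.Conn ωᶜ c b ∨ (R' ω c ∧ R' ω b) := fun ω =>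
    (hH' ω).conn_iff c b hcv hbv
  unfold slice2
  simp only [e1, e2, e3, e4, e5, e6]

end Slice2

section Hub2TimesTwo

variable {V E : Type*} [Fintype E] {G : MultiGraph V E}

open Classical in
/-- The `(2×)`-slice `(true, false)` of any two-edge hub is `Δ₂(G)`. -/
theorem slice2_hub2_tf {v t₁ t₂ a b c : V} (hv : G.Isolated v) (ht₁ : t₁ ≠ v) (ht₂ : t₂ ≠ v)
    (hav : a ≠ v) (hbv : b ≠ v) (hcv : c ≠ v) :
    (G.hub2 v t₁ t₂).slice2 (fun ω : Config E => extendOpt false (extendOpt true ω)) a b c =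
      G.slack2 a b c := by
  have key := slice2_eq_of_hubLike
    (R := fun ω x => (true = true ∧ G.Conn ω x t₁) ∨ (false = true ∧ G.Conn ω x t₂))
    (R' := fun ω x => ((!true) = true ∧ G.Conn ωᶜ x t₁) ∨ ((!false) = true ∧ G.Conn ωᶜ x t₂))
    hav hbv hcv (fun ω => hubLike_hub2 hv ht₁ ht₂ ω true false) fun ω => by
      rw [compl_hub2]
      exact hubLike_hub2 hv ht₁ ht₂ ωᶜ (!true) (!false)
  rw [key, G.slack2_eq]
  simp only [Bool.not_true, Bool.not_false, Bool.false_eq_true, false_and, or_false, false_or,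
    true_and, conn_or_leaf]

open Classical in
/-- The `(2×)`-slice `(false, true)` of any two-edge hub is `Δ₂(G)`. -/
theorem slice2_hub2_ft {v t₁ t₂ a b c : V} (hv : G.Isolated v) (ht₁ : t₁ ≠ v) (ht₂ : t₂ ≠ v)
    (hav : a ≠ v) (hbv : b ≠ v) (hcv : c ≠ v) :
    (G.hub2 v t₁ t₂).slice2 (fun ω : Config E => extendOpt true (extendOpt false ω)) a b c =
      G.slack2 a b c := by
  have key := slice2_eq_of_hubLike
    (R := fun ω x => (false = true ∧ G.Conn ω x t₁) ∨ (true = true ∧ G.Conn ω x t₂))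
    (R' := fun ω x => ((!false) = true ∧ G.Conn ωᶜ x t₁) ∨ ((!true) = true ∧ G.Conn ωᶜ x t₂))
    hav hbv hcv (fun ω => hubLike_hub2 hv ht₁ ht₂ ω false true) fun ω => by
      rw [compl_hub2]
      exact hubLike_hub2 hv ht₁ ht₂ ωᶜ (!false) (!true)
  rw [key, G.slack2_eq]
  simp only [Bool.not_true, Bool.not_false, Bool.false_eq_true, false_and, or_false, false_or,
    true_and, conn_or_leaf]

open Classical in
/-- The `(2×)`-slice `(false, false)` of the `ab`-hub is `Δ₂(G)`. -/
theorem slice2_hub2_ab_ff {v a b c : V} (hv : G.Isolated v) (hav : a ≠ v) (hbv : b ≠ v)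
    (hcv : c ≠ v) :
    (G.hub2 v a b).slice2 (fun ω : Config E => extendOpt false (extendOpt false ω)) a b c =
      G.slack2 a b c := by
  have key := slice2_eq_of_hubLike
    (R := fun ω x => (false = true ∧ G.Conn ω x a) ∨ (false = true ∧ G.Conn ω x b))
    (R' := fun ω x => ((!false) = true ∧ G.Conn ωᶜ x a) ∨ ((!false) = true ∧ G.Conn ωᶜ x b))
    hav hbv hcv (fun ω => hubLike_hub2 hv hav hbv ω false false) fun ω => by
      rw [compl_hub2]
      exact hubLike_hub2 hv hav hbv ωᶜ (!false) (!false)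
  rw [key, G.slack2_eq]
  simp only [Bool.not_false, Bool.false_eq_true, false_and, or_false, true_and, closed_pair_ab_iff]

open Classical in
/-- The `(2×)`-slice `(true, true)` of the `ab`-hub vanishes. -/
theorem slice2_hub2_ab_tt {v a b c : V} (hv : G.Isolated v) (hav : a ≠ v) (hbv : b ≠ v)
    (hcv : c ≠ v) :
    (G.hub2 v a b).slice2 (fun ω : Config E => extendOpt true (extendOpt true ω)) a b c = 0 := by
  have key := slice2_eq_of_hubLike
    (R := fun ω x => (true = true ∧ G.Conn ω x a) ∨ (true = true ∧ G.Conn ω x b))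
    (R' := fun ω x => ((!true) = true ∧ G.Conn ωᶜ x a) ∨ ((!true) = true ∧ G.Conn ωᶜ x b))
    hav hbv hcv (fun ω => hubLike_hub2 hv hav hbv ω true true) fun ω => by
      rw [compl_hub2]
      exact hubLike_hub2 hv hav hbv ωᶜ (!true) (!true)
  rw [key]
  simp only [Bool.not_true, Bool.false_eq_true, false_and, or_false, true_and,
    open_pair_ab_conn_iff, open_pair_ab_not_ac_iff, open_pair_ab_cell_ac_iff,
    open_pair_ab_cell_bc_iff, Finset.filter_false, Finset.card_empty, Nat.cast_zero, add_zero]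
  rw [← mul_sub, mul_eq_zero, sub_eq_zero, Nat.cast_inj]
  right
  convert card_filter_compl (fun ω => ¬ G.Conn ω c a ∧ ¬ G.Conn ω c b) using 2 <;>
    (ext ω; simp only [Finset.mem_filter])

open Classical in
/-- **(H1)₂**: `Δ₂(G + v_{ab}) = 3·Δ₂(G)`. -/
theorem slack2_hub2_ab {v a b c : V} (hv : G.Isolated v) (hav : a ≠ v) (hbv : b ≠ v)
    (hcv : c ≠ v) : (G.hub2 v a b).slack2 a b c = 3 * G.slack2 a b c := by
  rw [slack2_hub2_eq, slice2_hub2_ab_ff hv hav hbv hcv, slice2_hub2_tf hv hav hbv hav hbv hcv,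
    slice2_hub2_ft hv hav hbv hav hbv hcv, slice2_hub2_ab_tt hv hav hbv hcv]
  ring

/-- **`(2×)` is closed under attaching an `ab`-hub** (the factor `3` is exact). -/
theorem twoTimes_hub2_ab {v a b c : V} (hv : G.Isolated v) (hav : a ≠ v) (hbv : b ≠ v)
    (hcv : c ≠ v) (h : G.TwoTimes a b c) : (G.hub2 v a b).TwoTimes a b c := by
  rw [twoTimes_iff_slack2_nonneg] at h ⊢
  rw [slack2_hub2_ab hv hav hbv hcv]
  omega

open Classical in
/-- The `(2×)`-slice `(false, false)` of the `ac`-hub: `2·#ab|c + #ac|b + #bc|a`, no `N_AB`. -/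
theorem slice2_hub2_ac_ff {v a b c : V} (hv : G.Isolated v) (hav : a ≠ v) (hbv : b ≠ v)
    (hcv : c ≠ v) :
    (G.hub2 v a c).slice2 (fun ω : Config E => extendOpt false (extendOpt false ω)) a b c =
      2 * ((univ.filter fun ω : Config E => G.Conn ω a b ∧ ¬ G.Conn ω a c).card : ℤ) +
        ((univ.filter fun ω : Config E => G.Conn ω c a ∧ ¬ G.Conn ω c b).card : ℤ) +
        ((univ.filter fun ω : Config E => G.Conn ω c b ∧ ¬ G.Conn ω c a).card : ℤ) := by
  have key := slice2_eq_of_hubLike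
    (R := fun ω x => (false = true ∧ G.Conn ω x a) ∨ (false = true ∧ G.Conn ω x c))
    (R' := fun ω x => ((!false) = true ∧ G.Conn ωᶜ x a) ∨ ((!false) = true ∧ G.Conn ωᶜ x c))
    hav hbv hcv (fun ω => hubLike_hub2 hv hav hcv ω false false) fun ω => by
      rw [compl_hub2]
      exact hubLike_hub2 hv hav hcv ωᶜ (!false) (!false)
  rw [key]
  simp only [Bool.not_false, Bool.false_eq_true, false_and, or_false, true_and, closed_pair_ac_iff,
    and_false, Finset.filter_false, Finset.card_empty, Nat.cast_zero, mul_zero, sub_zero]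

open Classical in
/-- The `(2×)`-slice `(true, true)` of the `ac`-hub. -/
theorem slice2_hub2_ac_tt {v a b c : V} (hv : G.Isolated v) (hav : a ≠ v) (hbv : b ≠ v)
    (hcv : c ≠ v) :
    (G.hub2 v a c).slice2 (fun ω : Config E => extendOpt true (extendOpt true ω)) a b c =
      ((univ.filter fun ω : Config E => ¬ G.Conn ω a b ∧ ¬ G.Conn ω b c).card : ℤ) -
        2 * ((univ.filter fun ω : Config E =>
          (G.Conn ω a b ∨ G.Conn ω c b) ∧ ¬ G.Conn ωᶜ c a ∧ ¬ G.Conn ωᶜ c b).card : ℤ) := by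
  have key := slice2_eq_of_hubLike
    (R := fun ω x => (true = true ∧ G.Conn ω x a) ∨ (true = true ∧ G.Conn ω x c))
    (R' := fun ω x => ((!true) = true ∧ G.Conn ωᶜ x a) ∨ ((!true) = true ∧ G.Conn ωᶜ x c))
    hav hbv hcv (fun ω => hubLike_hub2 hv hav hcv ω true true) fun ω => by
      rw [compl_hub2]
      exact hubLike_hub2 hv hav hcv ωᶜ (!true) (!true)
  rw [key]
  simp only [Bool.not_true, Bool.false_eq_true, false_and, or_false, true_and]
  simp only [open_pair_ac_not_ac_iff (a := a) (c := c), open_pair_ac_not_ca_iff (a := a) (c := c),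
    and_false, Finset.filter_false, Finset.card_empty, Nat.cast_zero, mul_zero, add_zero, zero_add]
  simp only [open_pair_ac_cell_ac_iff (a := a) (b := b) (c := c),
    open_pair_ac_conn_ab_iff (a := a) (b := b) (c := c)]

open Classical in
/-- **(H2)₂**: `Δ₂(G + v_{ac}) = 3·Δ₂(G) + #{a ≁ b, b ≁ c} − 2·#X_b`. -/
theorem slack2_hub2_ac {v a b c : V} (hv : G.Isolated v) (hav : a ≠ v) (hbv : b ≠ v)
    (hcv : c ≠ v) :
    (G.hub2 v a c).slack2 a b c =
      3 * G.slack2 a b c +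
        ((univ.filter fun ω : Config E => ¬ G.Conn ω a b ∧ ¬ G.Conn ω b c).card : ℤ) -
        2 * ((univ.filter fun ω : Config E =>
          G.Conn ω c b ∧ ¬ G.Conn ω c a ∧ ¬ G.Conn ωᶜ c a ∧ ¬ G.Conn ωᶜ c b).card : ℤ) := by
  rw [slack2_hub2_eq, slice2_hub2_ac_ff hv hav hbv hcv, slice2_hub2_tf hv hav hcv hav hbv hcv,
    slice2_hub2_ft hv hav hcv hav hbv hcv, slice2_hub2_ac_tt hv hav hbv hcv, card_nAB_or_cb_eq,
    G.slack2_eq]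
  push_cast
  ring

end Hub2TimesTwo

end MultiGraph

end PercRepro
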